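import Summits.Ventures.AbcSig.Sieve.EisensteinChi
import Mathlib.NumberTheory.ArithmeticFunction.Misc

/-!
# Venture AbcSig — FAST kernel checker for module M6χ (σ from prime factorisations)

HONEST FRAMING. Certificate checker of a COMPUTATION cell (`pub-abcsig`); no Diophantine statement, no claim on ABC or
any summit. `Sieve/EisensteinChi.lean` defines the M6χ congruence check with the Eisenstein coefficient
`a_m(G_λ) = Σ_t λ_t [t ∣ m] σ₁^{χ,χ}(m/t)` evaluated as a divisor sum over `List.range` — quadratic in the Sturm bound
`B` and too heavy for the kernel at the levels the cell needs (`B = 703 … 1770` for `N = 2C²`, `C ∈ {37, …, 59}`: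
"(kernel) excessive memory consumption"). This file proves the two classical identities that make the check linear
in `B` and packages them in a second certificate format with the SAME soundness conclusion
(`NewformModel.EisensteinChiCongruent`, unchanged):

* `eulerChi_mul`, `sigmaChi_eq_mul` — for an odd prime `C`, `χ = (·/C)` is completely multiplicative
  (`eulerChi_eq_legendreSym` + `legendreSym.mul`), hence `σ₁^{χ,χ}(m) = Σ_{d ∣ m} χ(m/d)χ(d)d = χ(m)·σ₁(m)`
  (PROVED here, `sigmaChi C m = eulerChi C m * sigmaL m`).
* `sigmaL_eq_sum_divisors`, `sigmaOfFac_eq_sigmaL` — `sigmaL m = Σ_{d ∣ m} d = σ₁(m)` (Mathlib's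
  `ArithmeticFunction.sigma 1`), and for a checked prime factorisation `fac` of `m`,
  `σ₁(m) = ∏_{(p,j) ∈ fac} (1 + p + ⋯ + p^j)` (PROVED here from `ArithmeticFunction.isMultiplicative_sigma` and
  `sigma_one_apply_prime_pow`).
* `primeCert`, `primeCert_sound` — primality by trial division up to `⌊√p⌋` (Mathlib's `Decidable (Nat.Prime p)`
  instance tries every `d < p`; deciding it afresh for every prime factor of every `m ≤ B` was the other half of the
  cost).
* `EisChiCertF` — the certificate carries a prime table `[(p, ⌊√p⌋)]` (= the primes of the extended data, checked
  once each by `primeCert`) and, for every `1 ≤ m ≤ B`, the factorisation of `m` AND of `m/t` for the `t > 1` of the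
  combination dividing `m`; `EisChiCertF.check` (Boolean, `decide`) verifies each factorisation's shape, that its
  bases carry eigenvalue entries (hence are primes of the table), and compares `a_m(f)` (newform recursions, bookkeeping of `Sieve/Eisenstein.lean` via `toEis`)
  with `Σ_t λ_t [t ∣ m] χ(m/t)·σ_fac(m/t)` modulo `n`. THEOREM `EisChiCertF.check_sound`: a passing check gives
  `M.EisensteinChiCongruent f ψ c.C c.lam c.B ∧ SturmReaches N c.B` exactly as `EisChiCert.check_sound` does.

References: as in `Sieve/EisensteinChi.lean`; σ multiplicativity e.g. Hardy–Wright Thm. 275 (here: Mathlib).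
-/

namespace Summit.Ventures.AbcSig

/-! ## `χ` is multiplicative; `σ₁^{χ,χ} = χ · σ₁` -/

/-- `(ab/C) = (a/C)(b/C)` for the computed Legendre symbol, `C` an odd prime. -/
theorem eulerChi_mul (C : ℕ) [Fact C.Prime] (hC2 : C ≠ 2) (a b : ℕ) :
    eulerChi C (a * b) = eulerChi C a * eulerChi C b := by
  rw [eulerChi_eq_legendreSym C hC2, eulerChi_eq_legendreSym C hC2, eulerChi_eq_legendreSym C hC2, Nat.cast_mul,
    legendreSym.mul]

/-- **`σ₁^{χ,χ}(m) = χ(m)·σ₁(m)`** for `χ = (·/C)`, `C` an odd prime. -/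
theorem sigmaChi_eq_mul (C : ℕ) [Fact C.Prime] (hC2 : C ≠ 2) (m : ℕ) :
    sigmaChi C m = eulerChi C m * (sigmaL m : ℤ) := by
  have key : ∀ L : List ℕ, (∀ d ∈ L, m % d = 0) →
      (L.map fun d : ℕ => eulerChi C (m / d) * eulerChi C d * (d : ℤ)).sum = eulerChi C m * ((L.sum : ℕ) : ℤ) := by
    intro L hL
    induction L with
    | nil => simp
    | cons d L ih =>
        have hd : m / d * d = m := Nat.div_mul_cancel (Nat.dvd_of_mod_eq_zero (hL d (by simp)))
        have ih' := ih (fun x hx => hL x (List.mem_cons_of_mem _ hx))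
        rw [List.map_cons, List.sum_cons, ih', List.sum_cons, Nat.cast_add, mul_add, ← eulerChi_mul C hC2, hd]
  unfold sigmaChi sigmaL
  rw [List.map_id]
  apply key
  intro d hd
  have h := (List.mem_filter.mp hd).2
  simp only [Bool.and_eq_true, decide_eq_true_eq, beq_iff_eq] at h
  exact h.2

/-! ## `σ₁` from a prime factorisation -/

/-- `1 + p + ⋯ + p^j`. -/
def geomSum (p : ℕ) : ℕ → ℕ
  | 0 => 1
  | j + 1 => p ^ (j + 1) + geomSum p j

/-- `geomSum p j = Σ_{i ≤ j} p^i`. -/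
lemma geomSum_eq (p : ℕ) : ∀ j : ℕ, geomSum p j = ∑ i ∈ Finset.range (j + 1), p ^ i
  | 0 => by simp [geomSum]
  | j + 1 => by rw [geomSum, Finset.sum_range_succ, geomSum_eq p j, add_comm]

/-- `σ₁(∏ p^j)` computed from a factorisation list: `∏ (1 + p + ⋯ + p^j)`. -/
def sigmaOfFac (fac : List (ℕ × ℕ)) : ℕ := (fac.map fun pk => geomSum pk.1 pk.2).prod

/-- List-range filtered sums are `Finset.range` sums. -/
lemma list_range_filter_map_sum (q : ℕ → Bool) (f : ℕ → ℕ) : ∀ n : ℕ,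
    (((List.range n).filter q).map f).sum = ∑ i ∈ Finset.range n, if q i = true then f i else 0
  | 0 => by simp
  | n + 1 => by
      rw [List.range_succ, List.filter_append, List.map_append, List.sum_append, Finset.sum_range_succ,
        list_range_filter_map_sum q f n]
      by_cases h : q n = true
      · simp [h]
      · simp [h]

/-- `sigmaL m = Σ_{d ∣ m} d` (Mathlib's `Nat.divisors`; both sides are `0` at `m = 0`). -/
theorem sigmaL_eq_sum_divisors (m : ℕ) : sigmaL m = ∑ d ∈ m.divisors, d := by
  unfold sigmaL
  rw [list_range_filter_map_sum, ← Finset.sum_filter]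
  refine Finset.sum_congr ?_ (fun d _ => rfl)
  ext d
  simp only [Finset.mem_filter, Finset.mem_range, Nat.mem_divisors, Bool.and_eq_true, decide_eq_true_eq,
    beq_iff_eq]
  constructor
  · rintro ⟨hd, hpos, hmod⟩
    exact ⟨Nat.dvd_of_mod_eq_zero hmod, by omega⟩
  · rintro ⟨hdvd, hm⟩
    have := Nat.le_of_dvd (by omega) hdvd
    exact ⟨by omega, Nat.pos_of_dvd_of_pos hdvd (by omega), Nat.mod_eq_zero_of_dvd hdvd⟩

/-- `sigmaL = σ₁` (Mathlib's arithmetic function). -/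
theorem sigmaL_eq_sigma (m : ℕ) : sigmaL m = ArithmeticFunction.sigma 1 m := by
  rw [sigmaL_eq_sum_divisors, ArithmeticFunction.sigma_one_apply]

/-- Multiplicativity: for distinct primes, `σ₁(∏ p^j) = ∏ σ₁(p^j) = ∏ (1 + ⋯ + p^j)`. -/
theorem sigmaOfFac_eq_sigma_prod : ∀ fac : List (ℕ × ℕ), (∀ pk ∈ fac, pk.1.Prime) → (fac.map Prod.fst).Nodup →
    sigmaOfFac fac = ArithmeticFunction.sigma 1 (fac.map fun pk => pk.1 ^ pk.2).prod
  | [], _, _ => by simp [sigmaOfFac]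
  | (p, j) :: fac, hprime, hnodup => by
      have hp : p.Prime := hprime (p, j) (by simp)
      have hrest : ∀ pk ∈ fac, pk.1.Prime := fun pk hpk => hprime pk (List.mem_cons_of_mem _ hpk)
      simp only [List.map_cons, List.nodup_cons] at hnodup
      obtain ⟨hpnot, hnd⟩ := hnodup
      have ih := sigmaOfFac_eq_sigma_prod fac hrest hnd
      have hcop : Nat.Coprime (p ^ j) (fac.map fun pk => pk.1 ^ pk.2).prod := by
        rw [Nat.coprime_list_prod_right_iff]
        intro x hx
        obtain ⟨qk, hqk, rfl⟩ := List.mem_map.mp hx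
        have hq : qk.1.Prime := hrest qk hqk
        have hne : p ≠ qk.1 := by
          intro h
          exact hpnot (h ▸ List.mem_map.mpr ⟨qk, hqk, rfl⟩)
        exact Nat.coprime_pow_primes _ _ hp hq hne
      simp only [sigmaOfFac, List.map_cons, List.prod_cons] at ih ⊢
      rw [ArithmeticFunction.isMultiplicative_sigma.map_mul_of_coprime hcop, ← ih,
        ArithmeticFunction.sigma_one_apply_prime_pow hp, geomSum_eq]

/-- **`σ₁(m)` from a checked factorisation:** `isFactorisation m fac ⇒ sigmaOfFac fac = sigmaL m`. -/
theorem sigmaOfFac_eq_sigmaL (m : ℕ) (fac : List (ℕ × ℕ)) (h : isFactorisation m fac = true) :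
    sigmaOfFac fac = sigmaL m := by
  simp only [isFactorisation, Bool.and_eq_true, beq_iff_eq, List.all_eq_true, decide_eq_true_eq] at h
  obtain ⟨⟨hprod, hall⟩, hnodup⟩ := h
  rw [sigmaL_eq_sigma, ← hprod]
  exact sigmaOfFac_eq_sigma_prod fac (fun pk hpk => (hall pk hpk).1) hnodup

/-! ## Primality by bounded trial division (cheap in the kernel) -/

/-- Trial-division primality certificate: `2 ≤ p < (k+1)²` and no `2 ≤ d ≤ k` divides `p`. (Mathlib's `Decidable
(Nat.Prime p)` instance tries every `d < p`, which is what made the first M6χ certificates too heavy for the kernel.) -/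
def primeCert (p k : ℕ) : Bool :=
  decide (2 ≤ p) && decide (p < (k + 1) * (k + 1)) &&
    (List.range (k + 1)).all fun d => decide (d < 2) || !(p % d == 0)

/-- Soundness of `primeCert` (via `Nat.minFac`: a composite `p` has a prime factor `q` with `q² ≤ p`). -/
theorem primeCert_sound (p k : ℕ) (h : primeCert p k = true) : p.Prime := by
  simp only [primeCert, Bool.and_eq_true, decide_eq_true_eq, List.all_eq_true, List.mem_range, Bool.or_eq_true,
    Bool.not_eq_true', beq_eq_false_iff_ne, ne_eq] at h
  obtain ⟨⟨h2, hlt⟩, hall⟩ := h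
  by_contra hnp
  have hpos : 0 < p := by omega
  have hsq := Nat.minFac_sq_le_self hpos hnp
  have hmp : (Nat.minFac p).Prime := Nat.minFac_prime (by omega)
  have hmd : Nat.minFac p ∣ p := Nat.minFac_dvd p
  have hm2 : 2 ≤ Nat.minFac p := hmp.two_le
  by_cases hmk : Nat.minFac p ≤ k
  · rcases hall (Nat.minFac p) (by omega) with hlt2 | hnd
    · omega
    · exact hnd (Nat.mod_eq_zero_of_dvd hmd)
  · have : (k + 1) * (k + 1) ≤ Nat.minFac p * Nat.minFac p := Nat.mul_le_mul (by omega) (by omega)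
    rw [pow_two] at hsq
    omega

/-- Factorisation SHAPE (product, exponents `≥ 1`, distinct bases) — primality of the bases is supplied separately. -/
def isFacShape (m : ℕ) (fac : List (ℕ × ℕ)) : Bool :=
  ((fac.map fun pk => pk.1 ^ pk.2).prod == m) && fac.all (fun pk => decide (1 ≤ pk.2)) &&
    decide (fac.map Prod.fst).Nodup

/-- Shape + primality of the bases = `isFactorisation`. -/
lemma isFactorisation_of_shape (m : ℕ) (fac : List (ℕ × ℕ)) (h : isFacShape m fac = true)
    (hp : ∀ pk ∈ fac, pk.1.Prime) : isFactorisation m fac = true := by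
  simp only [isFacShape, Bool.and_eq_true, beq_iff_eq, List.all_eq_true, decide_eq_true_eq] at h
  obtain ⟨⟨hprod, hexp⟩, hnodup⟩ := h
  simp only [isFactorisation, Bool.and_eq_true, beq_iff_eq, List.all_eq_true, decide_eq_true_eq]
  exact ⟨⟨hprod, fun pk hpk => ⟨hp pk hpk, hexp pk hpk⟩⟩, hnodup⟩

/-! ## The fast certificate -/

/-- One index row of a fast certificate: the prime factorisation of `m` and, for the `t > 1` of the combination
with `t ∣ m`, the pair `(t, prime factorisation of m/t)`. -/
abbrev FacRow := List (ℕ × ℕ) × List (ℕ × List (ℕ × ℕ))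

/-- A FAST M6χ certificate: as `EisChiCert` but with a trial-division prime table `ptab = [(p, ⌊√p⌋)]` listing the
primes of the extended data `X` in order, and `rows` (factorisations of `m` and of the `m/t`) instead of `facs`. -/
structure EisChiCertF where
  /-- the residue characteristic -/
  n : ℕ
  /-- `θ ≡ r (mod 𝔫)` -/
  r : ℤ
  /-- `(p, u_p)` with `d_p · u_p ≡ 1 (mod n)` -/
  dinv : List (ℕ × ℤ)
  /-- the odd prime `C` (`χ = (·/C)`, `C² ∣ N`) -/
  C : ℕ
  /-- the Eisenstein combination `(t, λ_t)`: `G_λ = Σ λ_t E_χ(tz)` -/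
  lam : List (ℕ × ℤ)
  /-- number of coefficients compared -/
  B : ℕ
  /-- prime factorisation of the level `N` -/
  facN : List (ℕ × ℕ)
  /-- `(p, k)` with `k = ⌊√p⌋` for the primes `p` of the data `X`, in the order of `X.coeffs` -/
  ptab : List (ℕ × ℕ)
  /-- for `m = 1, …, B`: (factorisation of `m`, [(t, factorisation of `m/t`)]) -/
  rows : List FacRow

/-- The eigenvalue bookkeeping part as an `EisCert` (so `EisCert.eigAt` / `eigZ` / `map_eig_eq` apply). -/
def EisChiCertF.toEis (c : EisChiCertF) : EisCert :=
  { n := c.n, r := c.r, dinv := c.dinv, lam := [], B := c.B, facN := c.facN, facs := [] }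

/-- The factorisation of `m/t` offered by the row (`t = 1`: that of `m` itself). -/
def FacRow.quot (row : FacRow) (t : ℕ) : Option (List (ℕ × ℕ)) :=
  if t = 1 then some row.1 else (row.2.find? fun tf => tf.1 == t).map Prod.snd

/-- A factorisation is USABLE: right shape and every base has an eigenvalue entry in `X` (hence, by the prime table,
is prime). -/
def EisChiCertF.facOK (c : EisChiCertF) (X : OrbitData) (m : ℕ) (fac : List (ℕ × ℕ)) : Bool :=
  isFacShape m fac && fac.all (fun pk => (c.toEis.eigAt X pk.1).isSome)

/-- The term `λ_t [t ∣ m] χ(m/t) σ₁(m/t)` computed from the row, `none` if a needed factorisation is missing or not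
usable. -/
def EisChiCertF.termF (c : EisChiCertF) (X : OrbitData) (m : ℕ) (row : FacRow) (tl : ℕ × ℤ) : Option ℤ :=
  if m % tl.1 = 0 then
    match row.quot tl.1 with
    | none => none
    | some f => if c.facOK X (m / tl.1) f then some (tl.2 * (eulerChi c.C (m / tl.1) * (sigmaOfFac f : ℤ)))
        else none
  else some 0

/-- `Σ_t` of `termF` over the combination (`none` if any term fails). -/
def EisChiCertF.gsumF (c : EisChiCertF) (X : OrbitData) (m : ℕ) (row : FacRow) : List (ℕ × ℤ) → Option ℤ
  | [] => some 0
  | tl :: lam =>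
      match c.termF X m row tl, c.gsumF X m row lam with
      | some a, some b => some (a + b)
      | _, _ => none

/-- Check of one index `m`: `row.1` is a usable factorisation of `m`, the Eisenstein side evaluates, and
`a_m(f) ≡ a_m(G_λ) (mod n)`. -/
def EisChiCertF.checkAt (c : EisChiCertF) (N : ℕ) (X : OrbitData) (m : ℕ) (row : FacRow) : Bool :=
  c.facOK X m row.1 &&
    match c.gsumF X m row c.lam with
    | none => false
    | some g => (coeffOfFac N (c.toEis.eigZ X) row.1 - g) % (c.n : ℤ) == 0

/-- `checkAt` for the indices `m, m+1, …` against the rows. -/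
def EisChiCertF.checkAll (c : EisChiCertF) (N : ℕ) (X : OrbitData) : ℕ → List FacRow → Bool
  | _, [] => true
  | m, row :: rows => c.checkAt N X m row && c.checkAll N X (m + 1) rows

/-- **The fast checker.** `C` an odd prime with `C² ∣ N`; `λ` supported on `t ≥ 1` with `t·C² ∣ N`; `facN`
factorises `N` with `6·B ≥ ψ(N)`; the prime table passes trial division and lists exactly the primes of `X.coeffs`
in order; exactly `B` rows; and `checkAt` for every `m = 1, …, B`. -/
def EisChiCertF.check (c : EisChiCertF) (N : ℕ) (X : OrbitData) : Bool :=
  decide c.C.Prime && decide (c.C ≠ 2) && decide (c.C ^ 2 ∣ N) &&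
    c.lam.all (fun tl => decide (tl.1 * c.C ^ 2 ∣ N) && decide (0 < tl.1)) &&
    isFactorisation N c.facN && decide (psiOfFac c.facN ≤ 6 * c.B) &&
    c.ptab.all (fun pk => primeCert pk.1 pk.2) && (X.coeffs.map CoeffEntry.ell == c.ptab.map Prod.fst) &&
    (c.rows.length == c.B) && c.checkAll N X 1 c.rows

/-! ## Soundness -/

/-- With a checked prime table, a prime that has an eigenvalue entry IS prime. -/
lemma EisChiCertF.prime_of_eigAt (c : EisChiCertF) (X : OrbitData)
    (htab : ∀ pk ∈ c.ptab, primeCert pk.1 pk.2 = true) (hX : X.coeffs.map CoeffEntry.ell = c.ptab.map Prod.fst)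
    (p : ℕ) (hp : (c.toEis.eigAt X p).isSome = true) : p.Prime := by
  obtain ⟨v, hv⟩ := Option.isSome_iff_exists.mp hp
  obtain ⟨e, he, u, hep, -, -⟩ := c.toEis.eigAt_spec X p v hv
  have hmem : p ∈ c.ptab.map Prod.fst := by
    rw [← hX, ← hep]
    exact List.mem_map.mpr ⟨e, he, rfl⟩
  obtain ⟨pk, hpk, hpk1⟩ := List.mem_map.mp hmem
  rw [← hpk1]
  exact primeCert_sound pk.1 pk.2 (htab pk hpk)

/-- A usable factorisation is a factorisation. -/
lemma EisChiCertF.facOK_sound (c : EisChiCertF) (X : OrbitData)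
    (htab : ∀ pk ∈ c.ptab, primeCert pk.1 pk.2 = true) (hX : X.coeffs.map CoeffEntry.ell = c.ptab.map Prod.fst)
    (m : ℕ) (fac : List (ℕ × ℕ)) (h : c.facOK X m fac = true) :
    isFactorisation m fac = true ∧ ∀ pk ∈ fac, (c.toEis.eigAt X pk.1).isSome = true := by
  simp only [EisChiCertF.facOK, Bool.and_eq_true, List.all_eq_true] at h
  exact ⟨isFactorisation_of_shape m fac h.1 (fun pk hpk => c.prime_of_eigAt X htab hX pk.1 (h.2 pk hpk)), h.2⟩

/-- A computed term is the true term `λ_t [t ∣ m] σ₁^{χ,χ}(m/t)`. -/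
lemma EisChiCertF.termF_sound (c : EisChiCertF) [Fact c.C.Prime] (hC2 : c.C ≠ 2) (X : OrbitData)
    (htab : ∀ pk ∈ c.ptab, primeCert pk.1 pk.2 = true) (hX : X.coeffs.map CoeffEntry.ell = c.ptab.map Prod.fst)
    (m : ℕ) (row : FacRow) (tl : ℕ × ℤ) (a : ℤ) (h : c.termF X m row tl = some a) :
    a = tl.2 * (if tl.1 ∣ m then sigmaChi c.C (m / tl.1) else 0) := by
  unfold EisChiCertF.termF at h
  by_cases hmod : m % tl.1 = 0
  · rw [if_pos hmod] at h
    rw [if_pos (Nat.dvd_of_mod_eq_zero hmod)]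
    split at h
    · simp at h
    · rename_i f hf
      by_cases hfac : c.facOK X (m / tl.1) f = true
      · rw [if_pos hfac] at h
        simp only [Option.some.injEq] at h
        rw [← h, sigmaChi_eq_mul c.C hC2, sigmaOfFac_eq_sigmaL _ f (c.facOK_sound X htab hX _ f hfac).1]
      · rw [if_neg hfac] at h
        simp at h
  · rw [if_neg hmod] at h
    simp only [Option.some.injEq] at h
    have hnd : ¬ tl.1 ∣ m := fun hd => hmod (Nat.mod_eq_zero_of_dvd hd)
    rw [if_neg hnd, ← h]
    simp

/-- The computed sum is `a_m(G_λ) = eisChiCoeff C lam m`. -/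
lemma EisChiCertF.gsumF_sound (c : EisChiCertF) [Fact c.C.Prime] (hC2 : c.C ≠ 2) (X : OrbitData)
    (htab : ∀ pk ∈ c.ptab, primeCert pk.1 pk.2 = true) (hX : X.coeffs.map CoeffEntry.ell = c.ptab.map Prod.fst)
    (m : ℕ) (row : FacRow) :
    ∀ (lam : List (ℕ × ℤ)) (g : ℤ), c.gsumF X m row lam = some g → g = eisChiCoeff c.C lam m
  | [], g, h => by simp [EisChiCertF.gsumF] at h; simp [eisChiCoeff, ← h]
  | tl :: lam, g, h => by
      unfold EisChiCertF.gsumF at h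
      split at h
      · rename_i a b ha hb
        simp only [Option.some.injEq] at h
        rw [← h, c.termF_sound hC2 X htab hX m row tl a ha, c.gsumF_sound hC2 X htab hX m row lam b hb]
        simp [eisChiCoeff]
      · simp at h

/-- One index: `checkAt = true` gives the congruence for `m` in `k`. -/
lemma EisChiCertF.checkAt_sound (c : EisChiCertF) [Fact c.C.Prime] (hC2 : c.C ≠ 2) {N : ℕ} (X : OrbitData)
    (htab : ∀ pk ∈ c.ptab, primeCert pk.1 pk.2 = true) (hX : X.coeffs.map CoeffEntry.ell = c.ptab.map Prod.fst)
    (M : NewformModel) (f : M.Form N) (θ : M.Coeff N f)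
    (hθ : ∀ e ∈ X.coeffs, (e.d : M.Coeff N f) * M.eig N f e.ell = evalL θ e.g) {k : Type} [Field k]
    [CharP k c.n] (ψ : M.Coeff N f →+* k) (hψ : ψ θ = (c.r : k)) (m : ℕ) (row : FacRow)
    (h : c.checkAt N X m row = true) :
    isFactorisation m row.1 = true ∧ ψ (coeffOfFac N (M.eig N f) row.1) = ((eisChiCoeff c.C c.lam m : ℤ) : k) := by
  unfold EisChiCertF.checkAt at h
  split at h
  · simp at h
  · rename_i g hg
    simp only [Bool.and_eq_true, beq_iff_eq] at h
    obtain ⟨hok, hcong⟩ := h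
    obtain ⟨hfac, hsome⟩ := c.facOK_sound X htab hX m row.1 hok
    refine ⟨hfac, ?_⟩
    rw [map_coeffOfFac]
    have hchar : CharP k c.toEis.n := ‹CharP k c.n›
    have hc : coeffOfFac N (fun p => ψ (M.eig N f p)) row.1 =
        coeffOfFac N (fun p => ((c.toEis.eigZ X p : ℤ) : k)) row.1 := by
      apply coeffOfFac_congr
      intro pk hpk
      obtain ⟨v, hv⟩ := Option.isSome_iff_exists.mp (hsome pk hpk)
      rw [c.toEis.map_eig_eq X M f θ hθ ψ hψ pk.1 v hv]
      simp [EisCert.eigZ, hv]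
    rw [hc]
    have hcast : coeffOfFac N (fun p => ((c.toEis.eigZ X p : ℤ) : k)) row.1 =
        ((coeffOfFac N (c.toEis.eigZ X) row.1 : ℤ) : k) := by
      have := map_coeffOfFac (Int.castRingHom k) N (c.toEis.eigZ X) row.1
      simpa using this.symm
    rw [hcast, ← c.gsumF_sound hC2 X htab hX m row c.lam g hg]
    exact intCast_eq_of_emod_eq c.n hcong

/-- All indices. -/
lemma EisChiCertF.checkAll_sound (c : EisChiCertF) [Fact c.C.Prime] (hC2 : c.C ≠ 2) {N : ℕ} (X : OrbitData)
    (htab : ∀ pk ∈ c.ptab, primeCert pk.1 pk.2 = true) (hX : X.coeffs.map CoeffEntry.ell = c.ptab.map Prod.fst)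
    (M : NewformModel) (f : M.Form N) (θ : M.Coeff N f)
    (hθ : ∀ e ∈ X.coeffs, (e.d : M.Coeff N f) * M.eig N f e.ell = evalL θ e.g) {k : Type} [Field k]
    [CharP k c.n] (ψ : M.Coeff N f →+* k) (hψ : ψ θ = (c.r : k)) :
    ∀ (rows : List FacRow) (m₀ : ℕ), c.checkAll N X m₀ rows = true →
      ∀ m, m₀ ≤ m → m < m₀ + rows.length → ∃ fac, isFactorisation m fac = true ∧
        ψ (coeffOfFac N (M.eig N f) fac) = ((eisChiCoeff c.C c.lam m : ℤ) : k)
  | [], m₀, _, m, h1, h2 => by simp at h2; omega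
  | row :: rows, m₀, h, m, h1, h2 => by
      simp only [EisChiCertF.checkAll, Bool.and_eq_true] at h
      obtain ⟨hhead, htail⟩ := h
      by_cases hm : m = m₀
      · subst hm
        exact ⟨row.1, c.checkAt_sound hC2 X htab hX M f θ hθ ψ hψ m row hhead⟩
      · exact c.checkAll_sound hC2 X htab hX M f θ hθ ψ hψ rows (m₀ + 1) htail m (by omega)
          (by simp only [List.length_cons] at h2; omega)

/-- **Soundness of the fast M6χ checker** — same conclusion as `EisChiCert.check_sound`. -/
theorem EisChiCertF.check_sound (c : EisChiCertF) {N : ℕ} (X : OrbitData) (h : c.check N X = true)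
    (M : NewformModel) (f : M.Form N) (θ : M.Coeff N f)
    (hθ : ∀ e ∈ X.coeffs, (e.d : M.Coeff N f) * M.eig N f e.ell = evalL θ e.g)
    {k : Type} [Field k] [CharP k c.n] (ψ : M.Coeff N f →+* k) (hψ : ψ θ = (c.r : k)) :
    M.EisensteinChiCongruent f ψ c.C c.lam c.B ∧ SturmReaches N c.B := by
  simp only [EisChiCertF.check, Bool.and_eq_true, List.all_eq_true, decide_eq_true_eq, beq_iff_eq] at h
  obtain ⟨⟨⟨⟨⟨⟨⟨⟨⟨hCp, hC2⟩, hCN⟩, hlam⟩, hfacN⟩, hpsi⟩, htab⟩, hX⟩, hlen⟩, hall⟩ := h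
  haveI : Fact c.C.Prime := ⟨hCp⟩
  refine ⟨⟨hCp, hC2, hCN, fun tl htl => hlam tl htl, ?_⟩, ⟨c.facN, hfacN, hpsi⟩⟩
  intro m h1 h2
  exact c.checkAll_sound hC2 X htab hX M f θ hθ ψ hψ c.rows 1 hall m h1 (by rw [hlen]; omega)

/-! ## Sanity examples (kernel) -/

/-- `σ₁(12) = 28` from the factorisation `2²·3`; `997` passes trial division with `k = 31`; `999` does not. -/
example : sigmaOfFac [(2, 2), (3, 1)] = 28 ∧ primeCert 997 31 = true ∧ primeCert 999 31 = false := by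
  decide +kernel

end Summit.Ventures.AbcSig
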